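/-
Copyright (c) 2026 the pub-hodgecm-mathlib formalisation cell (harness21).  Prover seat hodgecm-mathlib-K2Liu-p08 (g3): Track B «K2-LIT»,
hLiu418 = stmt-HodgeConjecture-24832; LEAD F0P6-plan (g13) RULING «M-157o» 2026-09-04T09:30:19Z (#42S-S5, road (d) «Fourier-coefficient road»),
file S5-W4.
-/
import Summits.HodgeConjecture.HodgeConjecture.Theorems.K2LiuSiegelDoubledUnipotentChart              -- ★ `exists_unip`, `map_smul_eq` (+ ★ Levi algebra ∕ matrix)
import Summits.HodgeConjecture.HodgeConjecture.Theorems.K2LiuSiegelEisensteinDoubledSummableReduction  -- ★ `norm_siegelDeltaCharacter`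
import Summits.HodgeConjecture.HodgeConjecture.Theorems.K2LiuWeylDeltaRational                        -- ★ `weylDelta_mem_ratH` (+ ★ D9 `weylDelta`, `unipDelta`)
import Literature.NumberTheory.Automorphic.DoubledUnitaryRankOneReductionRay                            -- ★ `conjAdele_posRealIdele`
import Literature.NumberTheory.Automorphic.IdeleClassGroupProofs                                        -- ★ `ideleNorm_posRealIdele_holds`, `coe_ideleNorm`
import Literature.NumberTheory.NumberFields.CMFieldTotallyNegativeGenerator                             -- ★ `IsCMField.exists_complexConj_ne`
import HarnessLib

/-!
# Crux `HLiu418`, road `K2_Liu`, #42S-S5 «incoherent pieces die», file S5-W4: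
# A SINGULAR SECTION VANISHES — a left-`H(L⁺)`-invariant function in the degenerate principal series `I_n(s, χ)` is `0` off the unitary axis

Cell `hodgecm-mathlib`, crux item hLiu418 = `stmt-HodgeConjecture-24832`; squad K2 ∕ K2Liu; prover K2Liu-p08 (g3).  THEOREMS ONLY (no `def`, no
instance, no notation, no named-fact hypothesis, no `sorry`); lane `--supports stmt-HodgeConjecture-24832 --as helper` (count-neutral helper).

THE STATEMENT (RULING M-157o, mechanism (iv), GENERIC `n`).  In the doubled Siegel frame of the tree (`H(𝔸) = HA L e dV hdV dW hdW = U(𝕍 ⊕ −𝕍)(𝔸)`,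
Siegel parabolic `P_Δ(𝔸)` = ★ `IsSiegelDelta`, inducing character `δ_{χ,s}(p) = χ(det_Δ p)|det_Δ p|^{s+n∕2}` = ★ `siegelDeltaCharacter`, sections
★ `IsSiegelDeltaSection χ s F : F(p h) = δ_{χ,s}(p) F(h)`): for a UNITARY `χ` and `2 Re s + n ≠ 0`, a section `F ∈ I_n(s, χ)` that is left-invariant
under the Weyl element `w_Δ` (★ `weylDelta`; a fortiori under `H(L⁺)`, ★ `weylDelta_mem_ratH`) is identically `0`
(`eq_zero_of_isSiegelDeltaSection_of_weylDelta`, `eq_zero_of_isSiegelDeltaSection_of_ratH`).  Consumer: S5-F2 `K2LiuRankOneCentralVanishing`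
(K2Liu-p01 (g7)) at `n := 1`, `s := 0`, `F := E⋆(0) = φ₀ + M⋆(0)φ₀ ∈ I₁(0, χ)` (S5-W3-d + F1b).

THE PROOF.
* §1 (any group `G`): the left-invariances `{t : F(t·g) = F(g) ∀g}` of a function are a subgroup, so invariance propagates to `Subgroup.closure`
  (`apply_mul_eq_of_mem_closure`); if some `m` in that closure acts on `F` by a scalar `c ≠ 1` then `F = 0` (`eq_zero_of_mem_closure_of_apply_mul`).
* §2 (frame algebra in `H(𝔸)`, adapted blocks `adapt M = R⁻¹ M R` of ★ `AdaptedBlocks`): `adapt(blk w_Δ) = (0 1; 1 0)`; the unipotent shape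
  `blk u = R (1 Y; 0 1) R⁻¹` (★ `exists_unip` for `T`-skew `Y`) forces `u ∈ N_Δ(𝔸)` (`mem_unipDelta_of_blk_eq_unip`); for a SCALAR skew parameter
  `Y = a • 1` (`a ∈ 𝔸_L^×`, `(c ⊗ 1) a = −a`) the (SL₂)-word `ω_a := n(a•1) · (w_Δ n(−a⁻¹•1) w_Δ) · n(a•1)` lies in the subgroup generated by `w_Δ` and
  `N_Δ(𝔸)` and has `adapt(blk ω_a) = (0, a; −a⁻¹, 0)`, so `ω_a ω_b⁻¹` is the LEVI element `m(ab⁻¹·1) = R (ab⁻¹, 0; 0, a⁻¹b) R⁻¹`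
  (`exists_levi_scalar_mem_closure`; ★ `isSiegelDelta_of_blk_eq_levi`, ★ `deltaBlock_of_blk_eq_levi`).
* §3: with `a = z(r)·δ`, `b = δ` (`δ ∈ L`, `c δ = −δ`, ★ `IsCMField.exists_complexConj_ne`; `z(r)` = ★ `posRealIdele`, `(c ⊗ 1)`-fixed ★
  `conjAdele_posRealIdele`, `|z(r)|_𝔸 = r^{[L:ℚ]}` ★ `ideleNorm_posRealIdele_holds`) the Levi element `m(z(r)·1)` has `modDelta = r^{n[L:ℚ]∕2} ≠ 1` for
  `r ≠ 1`, hence `‖δ_{χ,s}(m)‖ = modDelta^{2 Re s + n} ≠ 1` (★ `norm_siegelDeltaCharacter`); §1 with the generating set `{w_Δ} ∪ N_Δ(𝔸)`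
  (★ `apply_unipDelta_mul`) kills `F`.
HONEST LABEL.  `HC_CM` is proved only modulo the 7 printed citations (2 remaining named inputs: hLiu418 = `stmt-HodgeConjecture-24832`,
h413 = `stmt-HodgeConjecture-24833`) until rung 0 closes.

## References
* [JiangWu2016ChiB] D. Jiang, C. Wu, *On (χ,b)-factors of cuspidal automorphic representations of unitary groups I*, J. Number Theory 161 (2016),
  Prop. 4.1 (incoherent collections have no automorphic realisation — the mechanism of road (d)).
* [MoeglinWaldspurger1995] C. Mœglin, J.-L. Waldspurger, *Spectral decomposition and Eisenstein series* (1995), I.2.1 (`P = MN`, `w N w⁻¹ = N̄`),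
  II.1.7 (constant terms of Eisenstein series lie in `I(s) ⊕ I(−s)`).
* [HarrisKudlaSweet1996] M. Harris, S. Kudla, W. J. Sweet, J. Amer. Math. Soc. 9 (1996), §1 (1.11)–(1.12) (`m(a)`, `n(b)`, `w` on the doubled
  unitary group).
* [KudlaRallis1994] S. Kudla, S. Rallis, *A regularized Siegel–Weil formula: the first term identity*, Ann. of Math. 140 (1994), §1–§2.
* [WeilBNT1967] A. Weil, *Basic Number Theory* (1967), Ch. IV §4 (`|z(λ)|_𝔸 = λ^{[k:ℚ]}`).
-/

set_option autoImplicit false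
set_option linter.dupNamespace false -- the mandated namespace repeats `HodgeConjecture.HodgeConjecture`

noncomputable section

open scoped Matrix NNReal
open NumberField IsDedekindDomain

namespace Summit.HodgeConjecture.HodgeConjecture.Cruxes.HLiu418.K2LiuSingularSectionVanishes

open Literature.NumberTheory.GelbartRogawski1991.AdaptedBlocks
open Literature.NumberTheory.Automorphic Literature.NumberTheory.Automorphic.UnitaryGroup
open Literature.NumberTheory.GelbartRogawski1991 Literature.NumberTheory.GelbartRogawski1991.GRConstruction
open Literature.NumberTheory.K2Lit.SiegelDoubled Literature.NumberTheory.GaloisRepresentations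
open UnitaryDualPair
open Summit.HodgeConjecture.HodgeConjecture.Cruxes.HLiu418.K2LiuSiegelDoubledLeviAlgebra
open Summit.HodgeConjecture.HodgeConjecture.Cruxes.HLiu418.K2LiuSiegelDoubledBlkUnitary
open Summit.HodgeConjecture.HodgeConjecture.Cruxes.HLiu418.K2LiuSiegelDoubledLeviMatrix
open Summit.HodgeConjecture.HodgeConjecture.Cruxes.HLiu418.K2LiuSiegelDoubledUnipotentChart
open Summit.HodgeConjecture.HodgeConjecture.Cruxes.HLiu418.K2LiuSiegelEisensteinDoubledSummableReduction (norm_siegelDeltaCharacter)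
open Summit.HodgeConjecture.HodgeConjecture.Cruxes.HLiu418.K2LiuWeylDeltaRational (weylDelta_mem_ratH)

/-! ## §1 Left-invariances of a function form a subgroup; a non-trivial eigen-scalar on it kills the function -/

section Abstract

variable {G : Type*} [Group G] {V : Type*}

/-- **left-invariance propagates to the generated subgroup**: if `F(t g) = F(g)` for all `t ∈ T`, then `F(h g) = F(g)` for all `h` in
`Subgroup.closure T` (the left-invariances of `F` form a subgroup).  [cite: MoeglinWaldspurger1995, I.2.1] -/
theorem apply_mul_eq_of_mem_closure (F : G → V) {T : Set G} (hT : ∀ t ∈ T, ∀ g, F (t * g) = F g) {h : G}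
    (hh : h ∈ Subgroup.closure T) (g : G) : F (h * g) = F g := by
  induction hh using Subgroup.closure_induction generalizing g with
  | mem x hx => exact hT x hx g
  | one => rw [one_mul]
  | mul x y _ _ ihx ihy => rw [mul_assoc, ihx, ihy]
  | inv x _ ih => rw [← ih (x⁻¹ * g), mul_inv_cancel_left]

/-- **THE KILL**: if `F` is left-invariant under `T` and some `m ∈ Subgroup.closure T` acts by `F(m g) = c · F(g)` with `c ≠ 1`, then `F = 0`
(ring-valued `F`, no zero divisors: `(c − 1) F(g) = 0`).  [cite: JiangWu2016ChiB, Prop. 4.1] [cite: MoeglinWaldspurger1995, II.1.7] -/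
theorem eq_zero_of_mem_closure_of_apply_mul {R : Type*} [Ring R] [NoZeroDivisors R] (F : G → R) {T : Set G}
    (hT : ∀ t ∈ T, ∀ g, F (t * g) = F g) {m : G} (hm : m ∈ Subgroup.closure T) {c : R} (hc : c ≠ 1)
    (hFm : ∀ g, F (m * g) = c * F g) : F = 0 := by
  funext g
  have h := apply_mul_eq_of_mem_closure F hT hm g
  rw [hFm g] at h
  have h0 : (c - 1) * F g = 0 := by rw [sub_mul, one_mul, h, sub_self]
  exact (mul_eq_zero.1 h0).resolve_left (sub_ne_zero.2 hc)

end Abstract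

/-! ## §2 Frame algebra in the doubled group: `w_Δ`, unipotent shapes, the (SL₂)-word and the scalar Levi element -/

section Frame

variable {R : Type*} [CommRing R] {ι : Type*} [Fintype ι] [DecidableEq ι] [Invertible (2 : R)]

/-- `adapt (diag(1, −1)) = (0 1; 1 0)`: in the adapted frame `(Δ, Δ⁻)` the Weyl element swaps the two Lagrangians.
[cite: HarrisKudlaSweet1996, §1 (1.11)] -/
theorem adapt_fromBlocks_one_neg_one :
    adapt (Matrix.fromBlocks (1 : Matrix ι ι R) 0 0 (-1)) = Matrix.fromBlocks 0 1 1 0 := by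
  have key : ⅟(2 : R) • ((1 : Matrix ι ι R) + 1) = 1 := by
    rw [← two_smul R (1 : Matrix ι ι R), smul_smul, invOf_mul_self, one_smul]
  rw [adapt_eq, blkA, blkB, blkC, blkD]
  simp only [Matrix.toBlocks_fromBlocks₁₁, Matrix.toBlocks_fromBlocks₁₂, Matrix.toBlocks_fromBlocks₂₁, Matrix.toBlocks_fromBlocks₂₂,
    add_zero, sub_zero, add_neg_cancel, sub_neg_eq_add, smul_zero, key]

omit [Invertible (2 : R)] in
/-- the (SL₂)-word in adapted blocks, for commuting scalar parameters: `(1 a; 0 1)(0 1; 1 0)(1 b; 0 1)(0 1; 1 0)(1 a; 0 1) = (0 a; b 0)` when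
`a b = −1` (all blocks scalar: `a • 1`, `b • 1`).  [cite: HarrisKudlaSweet1996, §1 (1.11)–(1.12)] -/
theorem word_fromBlocks (a b : R) (hab : a * b = -1) :
    Matrix.fromBlocks (1 : Matrix ι ι R) (a • (1 : Matrix ι ι R)) (0 : Matrix ι ι R) (1 : Matrix ι ι R) *
          Matrix.fromBlocks (0 : Matrix ι ι R) (1 : Matrix ι ι R) (1 : Matrix ι ι R) (0 : Matrix ι ι R) *
          Matrix.fromBlocks (1 : Matrix ι ι R) (b • (1 : Matrix ι ι R)) (0 : Matrix ι ι R) (1 : Matrix ι ι R) *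
          Matrix.fromBlocks (0 : Matrix ι ι R) (1 : Matrix ι ι R) (1 : Matrix ι ι R) (0 : Matrix ι ι R) *
          Matrix.fromBlocks (1 : Matrix ι ι R) (a • (1 : Matrix ι ι R)) (0 : Matrix ι ι R) (1 : Matrix ι ι R) =
      Matrix.fromBlocks (0 : Matrix ι ι R) (a • (1 : Matrix ι ι R)) (b • (1 : Matrix ι ι R)) (0 : Matrix ι ι R) := by
  have hba : b * a = -1 := by rw [mul_comm, hab]
  simp only [Matrix.fromBlocks_multiply, Matrix.mul_one, Matrix.mul_zero, add_zero, zero_add, Matrix.mul_smul, smul_smul, hab, hba,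
    neg_one_smul]
  congr 1
  · exact neg_add_cancel _
  · rw [neg_add_cancel, smul_zero, zero_add]
  · exact neg_add_cancel _

omit [Invertible (2 : R)] in
/-- `(0 a; a' 0)(0 b'; b 0) = (a b, 0; 0, a' b')` for scalar blocks. [cite: HarrisKudlaSweet1996, §1 (1.11)] -/
theorem antidiag_mul_antidiag (a a' b b' : R) :
    Matrix.fromBlocks (0 : Matrix ι ι R) (a • (1 : Matrix ι ι R)) (a' • (1 : Matrix ι ι R)) (0 : Matrix ι ι R) *
        Matrix.fromBlocks (0 : Matrix ι ι R) (b' • (1 : Matrix ι ι R)) (b • (1 : Matrix ι ι R)) (0 : Matrix ι ι R) =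
      Matrix.fromBlocks ((a * b) • (1 : Matrix ι ι R)) (0 : Matrix ι ι R) (0 : Matrix ι ι R) ((a' * b') • (1 : Matrix ι ι R)) := by
  simp only [Matrix.fromBlocks_multiply, Matrix.mul_zero, add_zero, zero_add, Matrix.mul_smul, Matrix.mul_one, smul_smul, smul_zero]
  rw [mul_comm b a, mul_comm b' a']

end Frame

/-! ## §3 The doubled group `H(𝔸)`: unipotent shapes, the word `ω_a`, and the scalar Levi element in `⟨w_Δ, N_Δ(𝔸)⟩` -/

section Doubled

variable (L : Type) [Field L] [NumberField L] [IsCMField L]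
variable {N M n : ℕ} (e : Fin N × Fin M ≃ Fin n)
  (dV : Fin N → L) (hdV : ∀ i, IsCMField.complexConj L (dV i) = dV i)
  (dW : Fin M → L) (hdW : ∀ i, IsCMField.complexConj L (dW i) = dW i)

/-- an involutive-type bookkeeping: for a ring endomorphism `σ` and a unit `a` with `σ a = −a`, also `σ a⁻¹ = −a⁻¹`. [folklore] -/
theorem map_units_inv_eq_neg {A : Type*} [CommRing A] (σ : A →+* A) {a : Aˣ} (ha : σ (a : A) = -(a : A)) :
    σ ((a⁻¹ : Aˣ) : A) = -((a⁻¹ : Aˣ) : A) := by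
  have h1 : σ ((a⁻¹ : Aˣ) : A) * -(a : A) = 1 := by rw [← ha, ← map_mul, Units.inv_mul, map_one]
  calc σ ((a⁻¹ : Aˣ) : A) = σ ((a⁻¹ : Aˣ) : A) * (-(a : A) * -((a⁻¹ : Aˣ) : A)) := by rw [neg_mul_neg, Units.mul_inv, mul_one]
    _ = σ ((a⁻¹ : Aˣ) : A) * -(a : A) * -((a⁻¹ : Aˣ) : A) := by rw [mul_assoc]
    _ = -((a⁻¹ : Aˣ) : A) := by rw [h1, one_mul]

/-- **`adapt (blk w_Δ) = (0 1; 1 0)`** (★ `blk_weylDelta = diag(1, −1)`): the Weyl element swaps `Δ` and `Δ⁻`.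
[cite: HarrisKudlaSweet1996, §1 (1.11)] [cite: MoeglinWaldspurger1995, I.2.1] -/
theorem adapt_blk_weylDelta :
    adapt (blk L e dV hdV dW hdW (weylDelta L e dV hdV dW hdW)) =
      Matrix.fromBlocks (0 : Matrix (Fin n) (Fin n) (AdeleRing (𝓞 L) L)) (1 : Matrix (Fin n) (Fin n) (AdeleRing (𝓞 L) L))
        (1 : Matrix (Fin n) (Fin n) (AdeleRing (𝓞 L) L)) (0 : Matrix (Fin n) (Fin n) (AdeleRing (𝓞 L) L)) := by
  rw [blk_weylDelta]
  exact adapt_fromBlocks_one_neg_one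

/-- **a unipotent SHAPE is a unipotent ELEMENT**: `blk u = R (1 Y; 0 1) R⁻¹ ⇒ u ∈ N_Δ(𝔸)` (★ `mem_unipDelta_iff_blocks`: `u ∈ P_Δ`, `u|_Δ = 1`,
`u₂₂ − u₁₂ = 1`, read off the adapted blocks `A = D = 1`, `B = Y`, `C = 0` ★ `blk_unip`).  [cite: HarrisKudlaSweet1996, §1 (1.12)] [cite: MoeglinWaldspurger1995, I.2.1] -/
theorem mem_unipDelta_of_blk_eq_unip {u : HA L e dV hdV dW hdW} {Y : Matrix (Fin n) (Fin n) (AdeleRing (𝓞 L) L)}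
    (hu : blk L e dV hdV dW hdW u =
      cayR (AdeleRing (𝓞 L) L) (Fin n) * Matrix.fromBlocks 1 Y 0 1 * cayRinv (AdeleRing (𝓞 L) L) (Fin n)) :
    u ∈ unipDelta L e dV hdV dW hdW := by
  obtain ⟨hA, hB, hC, hD⟩ := blk_unip (L := AdeleRing (𝓞 L) L) (ι := Fin n) Y
  rw [mem_unipDelta_iff_blocks]
  refine ⟨?_, ?_, ?_⟩
  · rw [IsSiegelDelta, ← blkC_eq_zero_iff, hu]
    exact hC
  · rw [deltaBlock, ← blkA_add_blkC, hu, hA, hC, add_zero]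
  · have h1 : (blk L e dV hdV dW hdW u).toBlocks₁₁ + (blk L e dV hdV dW hdW u).toBlocks₁₂ = 1 := by
      rw [← blkA_add_blkC, hu, hA, hC, add_zero]
    have h2 : (blk L e dV hdV dW hdW u).toBlocks₂₁ + (blk L e dV hdV dW hdW u).toBlocks₂₂ = 1 := by
      rw [← blkA_sub_blkC, hu, hA, hC, sub_zero]
    have h3 : (blk L e dV hdV dW hdW u).toBlocks₁₁ - (blk L e dV hdV dW hdW u).toBlocks₁₂ = Y + 1 := by
      rw [← blkB_add_blkD, hu, hB, hD]
    have h4 : (blk L e dV hdV dW hdW u).toBlocks₂₁ - (blk L e dV hdV dW hdW u).toBlocks₂₂ = Y - 1 := by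
      rw [← blkB_sub_blkD, hu, hB, hD]
    have key : (2 : AdeleRing (𝓞 L) L) • ((blk L e dV hdV dW hdW u).toBlocks₂₂ - (blk L e dV hdV dW hdW u).toBlocks₁₂) =
        (2 : AdeleRing (𝓞 L) L) • (1 : Matrix (Fin n) (Fin n) (AdeleRing (𝓞 L) L)) := by
      rw [two_smul, two_smul,
        show (blk L e dV hdV dW hdW u).toBlocks₂₂ - (blk L e dV hdV dW hdW u).toBlocks₁₂ +
            ((blk L e dV hdV dW hdW u).toBlocks₂₂ - (blk L e dV hdV dW hdW u).toBlocks₁₂) =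
          ((blk L e dV hdV dW hdW u).toBlocks₂₁ + (blk L e dV hdV dW hdW u).toBlocks₂₂) -
              ((blk L e dV hdV dW hdW u).toBlocks₂₁ - (blk L e dV hdV dW hdW u).toBlocks₂₂) -
            (((blk L e dV hdV dW hdW u).toBlocks₁₁ + (blk L e dV hdV dW hdW u).toBlocks₁₂) -
              ((blk L e dV hdV dW hdW u).toBlocks₁₁ - (blk L e dV hdV dW hdW u).toBlocks₁₂)) by abel,
        h1, h2, h3, h4]
      abel
    have h := congrArg (fun X : Matrix (Fin n) (Fin n) (AdeleRing (𝓞 L) L) => ⅟(2 : AdeleRing (𝓞 L) L) • X) key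
    simpa only [smul_smul, invOf_mul_self, one_smul] using h

/-- **scalar skew parameters**: if `(c ⊗ 1) a = −a` then `Y = a • 1` is `T`-skew, `σ(Y)ᵀ T + T Y = 0` (the hypothesis of ★ `exists_unip`).
[cite: HarrisKudlaSweet1996, §1 (1.12)] -/
theorem skew_smul_one {a : AdeleRing (𝓞 L) L} (ha : conjAdele (Fp L) L (IsCMField.complexConj L) a = -a) :
    ((a • (1 : Matrix (Fin n) (Fin n) (AdeleRing (𝓞 L) L))).map (conjAdele (Fp L) L (IsCMField.complexConj L)))ᵀ *
        (gramR L e dV hdV dW hdW).map ((algebraMap L (AdeleRing (𝓞 L) L)).comp (algebraMap (Fp L) L)) +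
      (gramR L e dV hdV dW hdW).map ((algebraMap L (AdeleRing (𝓞 L) L)).comp (algebraMap (Fp L) L)) *
        (a • (1 : Matrix (Fin n) (Fin n) (AdeleRing (𝓞 L) L))) = 0 := by
  rw [map_smul_eq, ha, Matrix.map_one _ (map_zero _) (map_one _), Matrix.transpose_smul, Matrix.transpose_one, Matrix.smul_mul,
    Matrix.one_mul, Matrix.mul_smul, Matrix.mul_one, neg_smul, neg_add_cancel]

/-- **THE (SL₂)-WORD**: for a unit `a ∈ 𝔸_L^×` with `(c ⊗ 1) a = −a` there is `ω` in the subgroup of `H(𝔸)` generated by `w_Δ` and `N_Δ(𝔸)` —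
namely `ω = n(a•1) · w_Δ · n(−a⁻¹•1) · w_Δ · n(a•1)` (★ `exists_unip`) — with `adapt (blk ω) = (0, a•1; −a⁻¹•1, 0)`.
[cite: HarrisKudlaSweet1996, §1 (1.11)–(1.12)] [cite: MoeglinWaldspurger1995, I.2.1] -/
theorem exists_word_mem_closure {a : (AdeleRing (𝓞 L) L)ˣ}
    (ha : conjAdele (Fp L) L (IsCMField.complexConj L) (a : AdeleRing (𝓞 L) L) = -(a : AdeleRing (𝓞 L) L)) :
    ∃ ω ∈ Subgroup.closure ({weylDelta L e dV hdV dW hdW} ∪ (unipDelta L e dV hdV dW hdW : Set (HA L e dV hdV dW hdW))),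
      adapt (blk L e dV hdV dW hdW ω) =
        Matrix.fromBlocks (0 : Matrix (Fin n) (Fin n) (AdeleRing (𝓞 L) L)) ((a : AdeleRing (𝓞 L) L) • (1 : Matrix (Fin n) (Fin n) (AdeleRing (𝓞 L) L)))
          ((-((a⁻¹ : (AdeleRing (𝓞 L) L)ˣ) : AdeleRing (𝓞 L) L)) • (1 : Matrix (Fin n) (Fin n) (AdeleRing (𝓞 L) L)))
          (0 : Matrix (Fin n) (Fin n) (AdeleRing (𝓞 L) L)) := by
  have ha' : conjAdele (Fp L) L (IsCMField.complexConj L) (-((a⁻¹ : (AdeleRing (𝓞 L) L)ˣ) : AdeleRing (𝓞 L) L)) =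
      -(-((a⁻¹ : (AdeleRing (𝓞 L) L)ˣ) : AdeleRing (𝓞 L) L)) := by
    rw [map_neg, map_units_inv_eq_neg _ ha]
  obtain ⟨u₁, hu₁⟩ := exists_unip L e dV hdV dW hdW (skew_smul_one L e dV hdV dW hdW ha)
  obtain ⟨u₂, hu₂⟩ := exists_unip L e dV hdV dW hdW (skew_smul_one L e dV hdV dW hdW ha')
  have hu₁N := mem_unipDelta_of_blk_eq_unip L e dV hdV dW hdW hu₁
  have hu₂N := mem_unipDelta_of_blk_eq_unip L e dV hdV dW hdW hu₂
  have hwT : weylDelta L e dV hdV dW hdW ∈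
      Subgroup.closure ({weylDelta L e dV hdV dW hdW} ∪ (unipDelta L e dV hdV dW hdW : Set (HA L e dV hdV dW hdW))) :=
    Subgroup.subset_closure (Set.mem_union_left _ (Set.mem_singleton _))
  have hu₁T : u₁ ∈ Subgroup.closure ({weylDelta L e dV hdV dW hdW} ∪ (unipDelta L e dV hdV dW hdW : Set (HA L e dV hdV dW hdW))) :=
    Subgroup.subset_closure (Set.mem_union_right _ hu₁N)
  have hu₂T : u₂ ∈ Subgroup.closure ({weylDelta L e dV hdV dW hdW} ∪ (unipDelta L e dV hdV dW hdW : Set (HA L e dV hdV dW hdW))) :=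
    Subgroup.subset_closure (Set.mem_union_right _ hu₂N)
  refine ⟨u₁ * weylDelta L e dV hdV dW hdW * u₂ * weylDelta L e dV hdV dW hdW * u₁,
    mul_mem (mul_mem (mul_mem (mul_mem hu₁T hwT) hu₂T) hwT) hu₁T, ?_⟩
  have hab : (a : AdeleRing (𝓞 L) L) * -((a⁻¹ : (AdeleRing (𝓞 L) L)ˣ) : AdeleRing (𝓞 L) L) = -1 := by
    rw [mul_neg, Units.mul_inv]
  rw [blk_mul, blk_mul, blk_mul, blk_mul, adapt_mul, adapt_mul, adapt_mul, adapt_mul, hu₁, hu₂, adapt_unip, adapt_unip,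
    adapt_blk_weylDelta]
  exact word_fromBlocks _ _ hab

/-- **THE SCALAR LEVI ELEMENT IN `⟨w_Δ, N_Δ(𝔸)⟩`**: for units `a, b ∈ 𝔸_L^×` with `(c ⊗ 1) a = −a`, `(c ⊗ 1) b = −b`, the quotient
`p = ω_a ω_b⁻¹` of two words lies in the subgroup generated by `w_Δ` and `N_Δ(𝔸)` and is the Levi element
`blk p = R ((a b⁻¹)•1, 0; 0, (a⁻¹ b)•1) R⁻¹` (the shape of ★ `isSiegelDelta_of_blk_eq_levi` ∕ ★ `deltaBlock_of_blk_eq_levi`).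
[cite: HarrisKudlaSweet1996, §1 (1.11)] [cite: MoeglinWaldspurger1995, I.2.1] -/
theorem exists_levi_scalar_mem_closure {a b : (AdeleRing (𝓞 L) L)ˣ}
    (ha : conjAdele (Fp L) L (IsCMField.complexConj L) (a : AdeleRing (𝓞 L) L) = -(a : AdeleRing (𝓞 L) L))
    (hb : conjAdele (Fp L) L (IsCMField.complexConj L) (b : AdeleRing (𝓞 L) L) = -(b : AdeleRing (𝓞 L) L)) :
    ∃ p ∈ Subgroup.closure ({weylDelta L e dV hdV dW hdW} ∪ (unipDelta L e dV hdV dW hdW : Set (HA L e dV hdV dW hdW))),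
      blk L e dV hdV dW hdW p =
        cayR (AdeleRing (𝓞 L) L) (Fin n) *
          Matrix.fromBlocks (((a * b⁻¹ : (AdeleRing (𝓞 L) L)ˣ) : AdeleRing (𝓞 L) L) • (1 : Matrix (Fin n) (Fin n) (AdeleRing (𝓞 L) L))) 0 0
            (((a⁻¹ * b : (AdeleRing (𝓞 L) L)ˣ) : AdeleRing (𝓞 L) L) • (1 : Matrix (Fin n) (Fin n) (AdeleRing (𝓞 L) L))) *
          cayRinv (AdeleRing (𝓞 L) L) (Fin n) := by
  obtain ⟨ωa, ha_mem, hωa⟩ := exists_word_mem_closure L e dV hdV dW hdW ha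
  obtain ⟨ωb, hb_mem, hωb⟩ := exists_word_mem_closure L e dV hdV dW hdW hb
  refine ⟨ωa * ωb⁻¹, mul_mem ha_mem (inv_mem hb_mem), ?_⟩
  -- the adapted matrix of `ωb⁻¹`
  have hinv : adapt (blk L e dV hdV dW hdW ωb⁻¹) =
      Matrix.fromBlocks (0 : Matrix (Fin n) (Fin n) (AdeleRing (𝓞 L) L)) ((-(b : AdeleRing (𝓞 L) L)) • (1 : Matrix (Fin n) (Fin n) (AdeleRing (𝓞 L) L)))
        (((b⁻¹ : (AdeleRing (𝓞 L) L)ˣ) : AdeleRing (𝓞 L) L) • (1 : Matrix (Fin n) (Fin n) (AdeleRing (𝓞 L) L)))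
        (0 : Matrix (Fin n) (Fin n) (AdeleRing (𝓞 L) L)) := by
    have h1 : adapt (blk L e dV hdV dW hdW ωb⁻¹) * adapt (blk L e dV hdV dW hdW ωb) = 1 := by
      rw [← adapt_mul, ← blk_mul, inv_mul_cancel, blk_one, adapt_one]
    have h2 : Matrix.fromBlocks (0 : Matrix (Fin n) (Fin n) (AdeleRing (𝓞 L) L))
          ((-(b : AdeleRing (𝓞 L) L)) • (1 : Matrix (Fin n) (Fin n) (AdeleRing (𝓞 L) L)))
          (((b⁻¹ : (AdeleRing (𝓞 L) L)ˣ) : AdeleRing (𝓞 L) L) • (1 : Matrix (Fin n) (Fin n) (AdeleRing (𝓞 L) L)))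
          (0 : Matrix (Fin n) (Fin n) (AdeleRing (𝓞 L) L)) * adapt (blk L e dV hdV dW hdW ωb) = 1 := by
      rw [hωb, antidiag_mul_antidiag, neg_mul_neg, Units.mul_inv, Units.inv_mul, one_smul, Matrix.fromBlocks_one]
    rw [← Matrix.inv_eq_left_inv h1, Matrix.inv_eq_left_inv h2]
  rw [blk_mul, ← cayR_mul_adapt_mul_cayRinv (blk L e dV hdV dW hdW ωa * blk L e dV hdV dW hdW ωb⁻¹), adapt_mul, hωa, hinv,
    antidiag_mul_antidiag, neg_mul_neg, Units.val_mul, Units.val_mul]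

/-- **the modulus of a scalar Levi element**: if `blk p = R (t•1, 0; 0, D) R⁻¹` with `t ∈ 𝔸_L^×` then `det_Δ p = tⁿ` and
`modDelta p = |tⁿ|_𝔸^{1∕2}` (★ `deltaBlock_of_blk_eq_levi`, `det (t • 1) = tⁿ`).  [cite: HarrisKudlaSweet1996, §1 (1.11)] [cite: WeilBNT1967, Ch. IV §4] -/
theorem modDelta_of_blk_eq_levi_scalar {p : HA L e dV hdV dW hdW} {t : (AdeleRing (𝓞 L) L)ˣ} {D : Matrix (Fin n) (Fin n) (AdeleRing (𝓞 L) L)}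
    (hp : blk L e dV hdV dW hdW p =
      cayR (AdeleRing (𝓞 L) L) (Fin n) * Matrix.fromBlocks ((t : AdeleRing (𝓞 L) L) • (1 : Matrix (Fin n) (Fin n) (AdeleRing (𝓞 L) L))) 0 0 D *
        cayRinv (AdeleRing (𝓞 L) L) (Fin n)) :
    modDelta L e dV hdV dW hdW p = Real.sqrt (ideleNorm (t ^ n)) := by
  have hdet : detDelta L e dV hdV dW hdW p = ((t ^ n : (AdeleRing (𝓞 L) L)ˣ) : AdeleRing (𝓞 L) L) := by
    rw [detDelta, deltaBlock_of_blk_eq_levi L e dV hdV dW hdW hp, Matrix.det_smul, Matrix.det_one, mul_one, Fintype.card_fin,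
      Units.val_pow_eq_pow_val]
  have hu : IsUnit (detDelta L e dV hdV dW hdW p) := by rw [hdet]; exact Units.isUnit _
  have hunit : hu.unit = t ^ n := Units.ext (by rw [IsUnit.unit_spec, hdet])
  unfold modDelta
  rw [dif_pos hu, hunit]

omit [IsCMField L] in
/-- `|z(r)ⁿ|_𝔸^{1∕2} = r^{n[L:ℚ]∕2}`: the modulus of the ray Levi element, via ★ `ideleNorm_posRealIdele_holds` (`|z(r)|_𝔸 = r^{[L:ℚ]}`).
[cite: WeilBNT1967, Ch. IV §4] -/
theorem sqrt_ideleNorm_posRealIdele_pow (r : ℝ≥0ˣ) :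
    Real.sqrt (ideleNorm (posRealIdele L r ^ n)) = Real.sqrt (((r : ℝ≥0) : ℝ) ^ (Module.finrank ℚ L * n)) := by
  rw [← coe_ideleNorm, map_pow, ideleNorm_posRealIdele_holds L r, ← pow_mul, NNReal.coe_pow]

omit [IsCMField L] in
/-- … which is `≠ 1` as soon as `r ≠ 1` and `0 < n` (`[L:ℚ] ≥ 1`). [cite: WeilBNT1967, Ch. IV §4] -/
theorem sqrt_ideleNorm_posRealIdele_pow_ne_one (hn : 0 < n) {r : ℝ≥0ˣ} (hr : (r : ℝ≥0) ≠ 1) :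
    Real.sqrt (ideleNorm (posRealIdele L r ^ n)) ≠ 1 := by
  rw [sqrt_ideleNorm_posRealIdele_pow, ne_eq, Real.sqrt_eq_one, ← NNReal.coe_pow, ← NNReal.coe_one, NNReal.coe_inj,
    pow_eq_one_iff_left (Nat.mul_ne_zero (Module.finrank_pos (R := ℚ) (M := L)).ne' hn.ne')]
  exact hr

/-! ## §4 THE HEAD: a `w_Δ`-invariant (a fortiori `H(L⁺)`-invariant) Siegel section off the unitary axis is zero -/

/-- **S5-W4 — A SINGULAR SECTION VANISHES.**  Let `χ` be a unitary Hecke character of `L`, `s ∈ ℂ` with `2 Re s + n ≠ 0` (`n ≥ 1`), and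
`F ∈ I_n(s, χ)` a Siegel section on the doubled group `H(𝔸) = U(𝕍 ⊕ −𝕍)(𝔸)` (★ `IsSiegelDeltaSection χ s F`: `F(p h) = χ(det_Δ p)|det_Δ p|^{s+n∕2} F(h)`
on `P_Δ(𝔸)`).  If `F` is left-invariant under the Weyl element `w_Δ` then `F = 0`.
PROOF: `F` is left-invariant under `N_Δ(𝔸)` (★ `apply_unipDelta_mul`) and `w_Δ`, hence (§1) under the subgroup they generate, which contains
(§3, `a = z(2)δ`, `b = δ`, `c δ = −δ`) the scalar Levi element `m = m(z(2)·1)` with `modDelta m = 2^{n[L:ℚ]∕2} ≠ 1`; but `F(m h) = δ_{χ,s}(m) F(h)` with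
`‖δ_{χ,s}(m)‖ = modDelta(m)^{2 Re s + n} ≠ 1` (★ `norm_siegelDeltaCharacter`), so `F = 0` (§1 `eq_zero_of_mem_closure_of_apply_mul`).
This is mechanism (iv) of RULING M-157o: at the rank-one centre (`n := 1`, `s := 0`) it kills `E⋆(0) = φ₀ + M⋆(0)φ₀ ∈ I₁(0, χ)` once all its
non-degenerate Fourier coefficients vanish (S5-W1∕W2∕W3) — the incoherent rank-one Eisenstein series has no value at the centre.
[cite: JiangWu2016ChiB, Prop. 4.1] [cite: MoeglinWaldspurger1995, I.2.1, II.1.7] [cite: HarrisKudlaSweet1996, §1 (1.11)–(1.12)] [cite: WeilBNT1967, Ch. IV §4] -/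
theorem eq_zero_of_isSiegelDeltaSection_of_weylDelta (hn : 0 < n) {χ : HeckeCharacter L} (hχ : χ.IsUnitary) {s : ℂ}
    (hs : 2 * s.re + (n : ℝ) ≠ 0) {F : HA L e dV hdV dW hdW → ℂ} (hF : IsSiegelDeltaSection L e dV hdV dW hdW χ s F)
    (hw : ∀ h, F (weylDelta L e dV hdV dW hdW * h) = F h) : F = 0 := by
  -- a non-zero purely imaginary `δ ∈ L`
  obtain ⟨e₀, he₀⟩ := Literature.NumberTheory.NumberFields.IsCMField.exists_complexConj_ne L
  have hδ0 : e₀ - IsCMField.complexConj L e₀ ≠ 0 := sub_ne_zero.2 (Ne.symm he₀)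
  have hδc : IsCMField.complexConj L (e₀ - IsCMField.complexConj L e₀) = -(e₀ - IsCMField.complexConj L e₀) := by
    rw [map_sub, IsCMField.complexConj_apply_apply, neg_sub]
  -- the units `d = δ ⊗ 1`, `t = z(2)` of `𝔸_L`
  set d : (AdeleRing (𝓞 L) L)ˣ := Units.map (algebraMap L (AdeleRing (𝓞 L) L) : L →* AdeleRing (𝓞 L) L)
    (Units.mk0 (e₀ - IsCMField.complexConj L e₀) hδ0) with hd
  set r : ℝ≥0ˣ := Units.mk0 (2 : ℝ≥0) two_ne_zero with hr
  have hr1 : (r : ℝ≥0) ≠ 1 := by rw [hr, Units.val_mk0]; norm_num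
  set t : (AdeleRing (𝓞 L) L)ˣ := posRealIdele L r with ht
  have hσd : conjAdele (Fp L) L (IsCMField.complexConj L) (d : AdeleRing (𝓞 L) L) = -(d : AdeleRing (𝓞 L) L) := by
    change conjAdele (Fp L) L (IsCMField.complexConj L) (algebraMap L (AdeleRing (𝓞 L) L) (e₀ - IsCMField.complexConj L e₀)) =
      -(algebraMap L (AdeleRing (𝓞 L) L) (e₀ - IsCMField.complexConj L e₀))
    rw [← algebraMap_conj (Fp L) L (IsCMField.complexConj L) (e₀ - IsCMField.complexConj L e₀), ← map_neg, ← hδc]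
    rfl
  have hσt : conjAdele (Fp L) L (IsCMField.complexConj L) (t : AdeleRing (𝓞 L) L) = (t : AdeleRing (𝓞 L) L) :=
    DoubledUnitary.RankOneReduction.conjAdele_posRealIdele (Fp L) L (IsCMField.complexConj L) r
  have hσa : conjAdele (Fp L) L (IsCMField.complexConj L) ((t * d : (AdeleRing (𝓞 L) L)ˣ) : AdeleRing (𝓞 L) L) =
      -((t * d : (AdeleRing (𝓞 L) L)ˣ) : AdeleRing (𝓞 L) L) := by
    rw [Units.val_mul, map_mul, hσt, hσd, mul_neg]
  -- the scalar Levi element `m(t·1)` in `⟨w_Δ, N_Δ(𝔸)⟩`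
  obtain ⟨p, hp_mem, hp⟩ := exists_levi_scalar_mem_closure L e dV hdV dW hdW hσa hσd
  rw [mul_inv_cancel_right] at hp
  have hP : IsSiegelDelta L e dV hdV dW hdW p := isSiegelDelta_of_blk_eq_levi L e dV hdV dW hdW hp
  have hmod : modDelta L e dV hdV dW hdW p ≠ 1 := by
    rw [modDelta_of_blk_eq_levi_scalar L e dV hdV dW hdW hp]
    exact sqrt_ideleNorm_posRealIdele_pow_ne_one L hn hr1
  -- its eigen-scalar is not `1`
  have hc : siegelDeltaCharacter L e dV hdV dW hdW χ s p ≠ 1 := by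
    intro h1
    have hnorm := norm_siegelDeltaCharacter L e dV hdV dW hdW hχ s p
    have hpos := modDelta_pos L e dV hdV dW hdW p
    rw [h1, norm_one, Real.rpow_def_of_pos hpos, eq_comm, Real.exp_eq_one_iff, mul_eq_zero] at hnorm
    rcases hnorm with hlog | hexp
    · exact hmod (Real.eq_one_of_pos_of_log_eq_zero hpos hlog)
    · exact hs hexp
  -- §1 with the generating set `{w_Δ} ∪ N_Δ(𝔸)`
  refine eq_zero_of_mem_closure_of_apply_mul F
    (T := {weylDelta L e dV hdV dW hdW} ∪ (unipDelta L e dV hdV dW hdW : Set (HA L e dV hdV dW hdW))) ?_ hp_mem hc (hF p hP)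
  rintro x hx h
  rcases hx with hx | hx
  · rw [Set.mem_singleton_iff.1 hx]
    exact hw h
  · exact apply_unipDelta_mul hF hx h

/-- **S5-W4, automorphic form**: a Siegel section `F ∈ I_n(s, χ)` (unitary `χ`, `2 Re s + n ≠ 0`, `n ≥ 1`) that is left-invariant under the
rational points `H(L⁺)` is zero (★ `weylDelta_mem_ratH`).  [cite: JiangWu2016ChiB, Prop. 4.1] [cite: MoeglinWaldspurger1995, II.1.7] -/
theorem eq_zero_of_isSiegelDeltaSection_of_ratH (hn : 0 < n) {χ : HeckeCharacter L} (hχ : χ.IsUnitary) {s : ℂ}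
    (hs : 2 * s.re + (n : ℝ) ≠ 0) {F : HA L e dV hdV dW hdW → ℂ} (hF : IsSiegelDeltaSection L e dV hdV dW hdW χ s F)
    (hΓ : ∀ γ ∈ ratH L e dV hdV dW hdW, ∀ h, F (γ * h) = F h) : F = 0 :=
  eq_zero_of_isSiegelDeltaSection_of_weylDelta L e dV hdV dW hdW hn hχ hs hF (hΓ _ (weylDelta_mem_ratH L e dV hdV dW hdW))

/-- pointwise form of S5-W4 for consumers quantifying over `h`. [cite: JiangWu2016ChiB, Prop. 4.1] -/
theorem apply_eq_zero_of_isSiegelDeltaSection_of_ratH (hn : 0 < n) {χ : HeckeCharacter L} (hχ : χ.IsUnitary) {s : ℂ}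
    (hs : 2 * s.re + (n : ℝ) ≠ 0) {F : HA L e dV hdV dW hdW → ℂ} (hF : IsSiegelDeltaSection L e dV hdV dW hdW χ s F)
    (hΓ : ∀ γ ∈ ratH L e dV hdV dW hdW, ∀ h, F (γ * h) = F h) (h : HA L e dV hdV dW hdW) : F h = 0 :=
  congrFun (eq_zero_of_isSiegelDeltaSection_of_ratH L e dV hdV dW hdW hn hχ hs hF hΓ) h

end Doubled

end Summit.HodgeConjecture.HodgeConjecture.Cruxes.HLiu418.K2LiuSingularSectionVanishes

end
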